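import Literature.Computability.MetaComplexity.DPReconstructionKProgram
import Literature.Computability.AlgebraicComplexity.ValiantClasses
import HarnessLib

/-!
# Complexity meta: Hirahara's Thm. 3.12 — the `K`-complexity form of the reconstruction property of `DP_k`

Topic `Literature/Computability/MetaComplexity`. S. Hirahara, *Average-case hardness of NP from
exponential worst-case hardness assumptions*, STOC 2021 (ECCC TR21-058), Thm. 3.12 (p. 23):

> "Assume that there exists a pseudorandom generator `G = {G_n : {0,1}^{O(log n)} → {0,1}ⁿ}` computable
> in time `n^{O(1)}` and secure against linear-sized circuits. Then there exist a polynomial-time oracle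
> algorithm `C^{(-)}` and a polynomial `p` such that, for every `n`, `x ∈ {0,1}ⁿ`, parameters `k, δ⁻¹, s`,
> and for every randomized circuit `D` of size `s` such that
> `|Pr_{z,r}[D(DP_k(x; z); r) = 1] − Pr_{w,r}[D(w; r) = 1]| ≥ δ`, … `K^{p(ns/δ)}(x | D) ≤ k + log p(ns/δ)`."

This file proves the statement for the distinguishers the paper actually feeds to it (proofs of
Thm. 4.2, p. 29, and Thm. 5.2, p. 30): **uniform randomized polynomial-time tests with auxiliary
input** `(ω; r) ↦ [⟨a, ω ‖ r⟩ ∈ D₀]`, `D₀ ∈ P`, `a = ⟨1ᵗ, b⟩` (a unary time parameter and a short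
binary string), the conditional complexity "`x | D`" being realised as "`+ 2|b| + O(log t)`" in the
bound (the program stores `b` and the binary numeral of `t`):

* `Hirahara2021_dpReconstructionK` — **for every efficient universal machine `U`, every quick
  pseudorandom generator with logarithmic seed fooling linear-size circuits for all large output
  lengths (`IsSizePseudorandom (seedGenerator F (c ⌊log₂ N⌋ + c) N)`, `F ∈ FP` — the conclusion of
  Lemma 3.4, e.g. `exists_isSizePseudorandom_of_avgHard_E`), and every `D₀ ∈ P`, there is a polynomial
  `p` such that whenever the randomized test `1/e`-distinguishes `DP_k(x; ·)` from uniform,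
  `K^{p(N)}(x) ≤ k + 2|b| + ⌊log₂ p(N)⌋`, `N = t + |x| + k + m + e + |b|`.**

Proof as printed (p. 25), assembled from `DPReconstructionKCircuits.lean` (the two uses of the
generator: a seed `σ` fixing the test's coins with advantage `≥ 1/e − 2/N₁ ≥ 1/2e`,
`DPKCirc.exists_seed_dpAdvantage`; a seed `σ'` fixing the reconstruction's coins,
`DPKCirc.exists_seed_success`), `DPReconstructionHybrid.lean` (Lemma 3.14: one run fed with its own
`j`-bit advice succeeds with probability `≥ 1/(16ek·2^kk)`, `DPHybStr.exists_uniformProb_hrun_ge`),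
`DPReconstructionHybridProgram.lean` / `DPReconstructionKProgram.lean` (the run and the printing
program are polynomial time) and `KtViaRuler.lean` (the program `⟨e, ⟨u, ⟨numerals ‖ sgn ‖ σ ‖ σ',
⟨b, α⟩⟩⟩⟩` of length `|α| + 2|b| + O(log N)` prints `x` within `poly(N)` steps on `U`).

## References

* S. Hirahara, ECCC TR21-058 (2021): Thm. 3.12 and its proof (pp. 23–25), Lemma 3.14, Lemma 3.4,
  and the uses of Thm. 3.12 in the proofs of Thm. 4.2 (p. 29) and Thm. 5.2 (p. 30).
* O. Goldreich, L. A. Levin, STOC 1989 (Lemma 3.11).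
* S. Arora, B. Barak, CUP 2009, Def. 20.2, Lemma 20.3, Thm. 9.12.
-/

noncomputable section

namespace Literature.Computability.MetaComplexity

open _root_.Computability Polynomial Complexity Complexity.Brick Complexity.OracleCompose Filter Finset
open Literature.Computability.Cryptography Literature.Computability.AlgebraicComplexity

namespace DPK

/-! ### The parameters as functions of the size `N = t + n + k + m + e + |b|` -/

section Params

variable (d₁ d₂ N₀ c : ℕ)

/-- Bound on the hard-wired length of the first use: `2(2|a|+2+(nk+k))+2+m`. [folklore] -/
def L1b (N : ℕ) : ℕ := 2 * (2 * (3 * N + 2) + 2 + (N * N + N)) + 2 + N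
/-- **The first output length `N₁`** (above the first circuit size, `m`, `4e` and `N₀`). [folklore] -/
def N1f (N : ℕ) : ℕ := L1b N + (L1b N + 2) ^ (2 ^ d₁) + 5 * N + N₀ + 4
/-- **The number of wanted samples `M = 128 N⁵ + 1`** (`≥ 32e²k²n + 1`). [folklore] -/
def Mf (N : ℕ) : ℕ := 128 * N ^ 5 + 1
/-- Bound on the number `C` of coins of the run. [folklore] -/
def Cb (N : ℕ) : ℕ := N * N + (N + (DPHybProg.kkOf (Mf N) * N + DPHybProg.kkOf (Mf N)))
/-- Bound on the hard-wired length of the second use. [folklore] -/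
def HLb (N : ℕ) : ℕ := 2 * N + 2 + (2 * (3 * N + 2) + 2 * N + 2 * N + 2 * Mf N + 2 * N + N + 16)
/-- Bound on `2·HL + 2 + C`. [folklore] -/
def L2b (N : ℕ) : ℕ := 2 * HLb N + 2 + Cb N
/-- **The second output length `N₂`** (above the second circuit size, `C`, `32ekM` and `N₀`). [folklore] -/
def N2f (N : ℕ) : ℕ := L2b N + (L2b N + 2) ^ (2 ^ d₂) + Cb N + (32 * N * N * Mf N + 1) + N₀
/-- **The ruler bound `B`** (above every stored number). [folklore] -/
def Bf (N : ℕ) : ℕ := N + Mf N + N1f d₁ N₀ N + N2f d₂ N₀ N + Cb N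
/-- Bound on the payload length minus `2|b| + |α|`. [folklore] -/
def PLb (N : ℕ) : ℕ := 4 * (17 * (Nat.log 2 (Bf d₁ d₂ N₀ N) + 1) + 16) + 6 * (c * Nat.log 2 (Bf d₁ d₂ N₀ N) + c) + 20
/-- Bound on the argument of the time polynomial: `2^{|u|} + |payload| ≤ 2B + PLb + 3N`. [folklore] -/
def Argb (N : ℕ) : ℕ := 2 * Bf d₁ d₂ N₀ N + PLb d₁ d₂ N₀ c N + 3 * N

/-- `kkOf M ≤ M + 1`. [folklore] -/
theorem kkOf_le (M : ℕ) : DPHybProg.kkOf M ≤ M + 1 := by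
  unfold DPHybProg.kkOf
  have := Nat.log_le_self 2 M
  omega

/-- Polynomials are polynomially bounded. [folklore] -/
theorem isPBounded_eval (q : Polynomial ℕ) : IsPBounded fun n => q.eval n :=
  (isPBounded_iff_exists_polynomial_holds _).2 ⟨q, fun _ => le_rfl⟩

/-- `Mf` is polynomially bounded. [folklore] -/
theorem isPBounded_Mf : IsPBounded Mf :=
  IsPBounded.add_holds (IsPBounded.mul_holds (IsPBounded.const 128) (IsPBounded.pow_holds IsPBounded.id 5)) (IsPBounded.const 1)

/-- `kkOf ∘ Mf` is polynomially bounded. [folklore] -/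
theorem isPBounded_kk : IsPBounded fun N => DPHybProg.kkOf (Mf N) :=
  (IsPBounded.add_holds isPBounded_Mf (IsPBounded.const 1)).mono fun _ => kkOf_le _

/-- `Cb` is polynomially bounded. [folklore] -/
theorem isPBounded_Cb : IsPBounded Cb :=
  IsPBounded.add_holds (IsPBounded.mul_holds IsPBounded.id IsPBounded.id)
    (IsPBounded.add_holds IsPBounded.id (IsPBounded.add_holds (IsPBounded.mul_holds isPBounded_kk IsPBounded.id) isPBounded_kk))

/-- `L1b` is polynomially bounded. [folklore] -/
theorem isPBounded_L1b : IsPBounded L1b := by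
  unfold L1b
  exact IsPBounded.add_holds (IsPBounded.add_holds (IsPBounded.mul_holds (IsPBounded.const 2)
    (IsPBounded.add_holds (IsPBounded.add_holds (IsPBounded.mul_holds (IsPBounded.const 2)
      (IsPBounded.add_holds (IsPBounded.mul_holds (IsPBounded.const 3) IsPBounded.id) (IsPBounded.const 2))) (IsPBounded.const 2))
      (IsPBounded.add_holds (IsPBounded.mul_holds IsPBounded.id IsPBounded.id) IsPBounded.id))) (IsPBounded.const 2)) IsPBounded.id

/-- `N1f` is polynomially bounded. [folklore] -/
theorem isPBounded_N1f : IsPBounded (N1f d₁ N₀) := by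
  unfold N1f
  exact IsPBounded.add_holds (IsPBounded.add_holds (IsPBounded.add_holds (IsPBounded.add_holds isPBounded_L1b
    (IsPBounded.pow_holds (IsPBounded.add_holds isPBounded_L1b (IsPBounded.const 2)) _))
    (IsPBounded.mul_holds (IsPBounded.const 5) IsPBounded.id)) (IsPBounded.const N₀)) (IsPBounded.const 4)

/-- `HLb` is polynomially bounded. [folklore] -/
theorem isPBounded_HLb : IsPBounded HLb := by
  refine (IsPBounded.add_holds (IsPBounded.mul_holds (IsPBounded.const 20) IsPBounded.id)
    (IsPBounded.add_holds (IsPBounded.mul_holds (IsPBounded.const 2) isPBounded_Mf) (IsPBounded.const 22))).mono fun N => ?_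
  simp only [id_eq]
  unfold HLb; omega

/-- `L2b` is polynomially bounded. [folklore] -/
theorem isPBounded_L2b : IsPBounded L2b :=
  IsPBounded.add_holds (IsPBounded.add_holds (IsPBounded.mul_holds (IsPBounded.const 2) isPBounded_HLb) (IsPBounded.const 2)) isPBounded_Cb

/-- `N2f` is polynomially bounded. [folklore] -/
theorem isPBounded_N2f : IsPBounded (N2f d₂ N₀) := by
  unfold N2f
  exact IsPBounded.add_holds (IsPBounded.add_holds (IsPBounded.add_holds (IsPBounded.add_holds isPBounded_L2b
    (IsPBounded.pow_holds (IsPBounded.add_holds isPBounded_L2b (IsPBounded.const 2)) _)) isPBounded_Cb)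
    (IsPBounded.add_holds (IsPBounded.mul_holds (IsPBounded.mul_holds (IsPBounded.mul_holds (IsPBounded.const 32) IsPBounded.id)
      IsPBounded.id) isPBounded_Mf) (IsPBounded.const 1))) (IsPBounded.const N₀)

/-- `Bf` is polynomially bounded. [folklore] -/
theorem isPBounded_Bf : IsPBounded (Bf d₁ d₂ N₀) := by
  unfold Bf
  exact IsPBounded.add_holds (IsPBounded.add_holds (IsPBounded.add_holds (IsPBounded.add_holds IsPBounded.id isPBounded_Mf)
    (isPBounded_N1f d₁ N₀)) (isPBounded_N2f d₂ N₀)) isPBounded_Cb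

/-- `PLb` is polynomially bounded. [folklore] -/
theorem isPBounded_PLb : IsPBounded (PLb d₁ d₂ N₀ c) := by
  have hlog : IsPBounded fun N => Nat.log 2 (Bf d₁ d₂ N₀ N) := (isPBounded_Bf d₁ d₂ N₀).mono fun N => Nat.log_le_self 2 _
  unfold PLb
  exact IsPBounded.add_holds (IsPBounded.add_holds (IsPBounded.mul_holds (IsPBounded.const 4) (IsPBounded.add_holds
    (IsPBounded.mul_holds (IsPBounded.const 17) (IsPBounded.add_holds hlog (IsPBounded.const 1))) (IsPBounded.const 16)))
    (IsPBounded.mul_holds (IsPBounded.const 6) (IsPBounded.add_holds (IsPBounded.mul_holds (IsPBounded.const c) hlog) (IsPBounded.const c))))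
    (IsPBounded.const 20)

/-- `Argb` is polynomially bounded. [folklore] -/
theorem isPBounded_Argb : IsPBounded (Argb d₁ d₂ N₀ c) := by
  unfold Argb
  exact IsPBounded.add_holds (IsPBounded.add_holds (IsPBounded.mul_holds (IsPBounded.const 2) (isPBounded_Bf d₁ d₂ N₀))
    (isPBounded_PLb d₁ d₂ N₀ c)) (IsPBounded.mul_holds (IsPBounded.const 3) IsPBounded.id)

end Params

/-! ### Arithmetic -/

/-- Unary numerals are blocks of `1`s. [folklore] -/
private theorem unary_eq_ones (n : ℕ) : unaryEncodeNat n = ones n := Complexity.unaryEncodeNat_eq_replicate n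

/-- `2/N₁ ≤ 1/(2e)` once `N₁ ≥ 4e ≥ 4`. [folklore] -/
theorem two_div_le {e N₁ : ℕ} (he : 1 ≤ e) (h : 4 * e ≤ N₁) : (2 : ℝ) / N₁ ≤ 1 / (2 * e) := by
  have he' : (1 : ℝ) ≤ e := by exact_mod_cast he
  have h' : (4 : ℝ) * e ≤ N₁ := by exact_mod_cast h
  rw [div_le_div_iff₀ (by linarith) (by linarith)]
  linarith

/-- The seed condition of Lemma 3.14 from `2^kk − 1 ≥ 32e²k²n`. [folklore] -/
theorem seeds_enough {n e k kk : ℕ} (he : 1 ≤ e) (hk : 1 ≤ k) (h : 32 * e * e * k * k * n ≤ 2 ^ kk - 1) :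
    (n : ℝ) ≤ 2 * (1 / (2 * (e : ℝ)) / k / 4) ^ 2 * (2 ^ kk - 1 : ℕ) := by
  have he' : (1 : ℝ) ≤ e := by exact_mod_cast he
  have hk' : (1 : ℝ) ≤ k := by exact_mod_cast hk
  have h' : (32 : ℝ) * e * e * k * k * n ≤ (2 ^ kk - 1 : ℕ) := by exact_mod_cast h
  have hsq : 2 * (1 / (2 * (e : ℝ)) / k / 4) ^ 2 = 1 / (32 * e * e * k * k) := by
    field_simp; ring
  rw [hsq, one_div_mul_eq_div, le_div_iff₀ (by positivity)]
  nlinarith [show (0 : ℝ) ≤ n by positivity]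

/-- The fooling error of the second use is below the success probability: `1/N₂ < 1/(16ek·2^kk)`
once `N₂ > 32ekM ≥ 16ek·2^kk`. [folklore] -/
theorem inv_lt_theta {e k kk M N₂ : ℕ} (he : 1 ≤ e) (hk : 1 ≤ k) (hkk : 2 ^ kk ≤ 2 * M) (h : 32 * e * k * M + 1 ≤ N₂) :
    (1 : ℝ) / N₂ < 1 / (2 * (e : ℝ)) / k / 8 / 2 ^ kk := by
  have he' : (1 : ℝ) ≤ e := by exact_mod_cast he
  have hk' : (1 : ℝ) ≤ k := by exact_mod_cast hk
  have hkk' : (2 : ℝ) ^ kk ≤ 2 * M := by exact_mod_cast hkk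
  have h' : (32 : ℝ) * e * k * M + 1 ≤ N₂ := by exact_mod_cast h
  have hpos : (0 : ℝ) < 2 ^ kk := by positivity
  have hnn : (0 : ℝ) ≤ 32 * e * k * M := by positivity
  rw [show 1 / (2 * (e : ℝ)) / k / 8 / 2 ^ kk = 1 / (16 * e * k * 2 ^ kk) by field_simp; ring]
  rw [div_lt_div_iff₀ (by linarith) (by positivity), one_mul, one_mul]
  nlinarith [mul_le_mul_of_nonneg_left hkk' (show (0 : ℝ) ≤ 16 * e * k by positivity)]

/-- The logarithmic budget: `A(⌊log₂ B⌋ + 1) ≤ ⌊log₂ (2^A (P+2)^A + T)⌋` for `B ≤ P`. [folklore] -/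
theorem log_budget {A B P T : ℕ} (hBP : B ≤ P) : A * (Nat.log 2 B + 1) ≤ Nat.log 2 (2 ^ A * (P + 2) ^ A + T) := by
  have h1 : 2 ^ (A * (Nat.log 2 B + 1)) ≤ 2 ^ A * (P + 2) ^ A := by
    rw [show A * (Nat.log 2 B + 1) = A + Nat.log 2 B * A by ring, pow_add, pow_mul]
    refine Nat.mul_le_mul_left _ (Nat.pow_le_pow_left ?_ _)
    rcases Nat.eq_zero_or_pos B with rfl | hB
    · simp
    · exact ((Nat.pow_log_le_self 2 hB.ne').trans hBP).trans (Nat.le_add_right _ _)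
  exact Nat.le_log_of_pow_le one_lt_two (h1.trans (Nat.le_add_right _ _))

/-! ### The theorem -/

/-- **Hirahara 2021, Thm. 3.12 (deterministic reconstruction for `DP_k`), `K`-complexity form, for
uniform randomized polynomial-time tests with auxiliary input.** Let `U` be an efficient universal
machine, let `s ↦ F⟨1^N, s⟩↾N` (`F ∈ FP`, seeds of length `c⌊log₂ N⌋ + c`) be `SIZE(N)`-pseudorandom for
all large `N` (a quick logarithmic-seed generator fooling linear-size circuits — the conclusion of
Lemma 3.4), and let `D₀ ∈ P`. Then there is a polynomial `p` such that for all `t, b, x, k, m, e ≥ 1`: if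
the randomized test `(ω; r) ↦ [⟨⟨1ᵗ, b⟩, ω ‖ r⟩ ∈ D₀]` (`r ∈ {0,1}ᵐ`) `1/e`-distinguishes `DP_k(x; ·)`
from the uniform distribution on `{0,1}^{nk+k}` (`n = |x|`), then
`K^{p(N)}(x) ≤ k + 2|b| + ⌊log₂ p(N)⌋` with `N = t + n + k + m + e + |b|` — the paper's
`K^{p(ns/δ)}(x | D) ≤ k + log p(ns/δ)`, the description of `D` being `b` and the binary numeral of `t`.
Proof as printed: a seed `σ` of the generator fixes the test's coins keeping advantage `≥ 1/2e`
(`DPKCirc.exists_seed_dpAdvantage`); the hybrid argument with a `j`-bit advice (`j < k`) and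
Goldreich–Levin decoding reconstruct `x` from its own advice with probability `≥ 1/(16ek·2^kk)` over the
coins `w` (`DPHybStr.exists_uniformProb_hrun_ge`, Lemma 3.14); the success event is a polynomial-size
circuit in `w`, so a second seed `σ'` fixes `w` (`DPKCirc.exists_seed_success`); the program
`⟨numerals, sgn, σ, σ', b, α⟩` of the polynomial-time printing function (`DPKProg.gF`) then prints `x`
on `U` through the ruler device (`UniversalMachine.exists_ktAt_le_of_FP`).
[Hirahara 2021 (ECCC TR21-058), Thm. 3.12 (pp. 23–25) with Lemma 3.14 and Lemma 3.11; Goldreich–Levin 1989]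
[cite: Hirahara2021, Thm. 3.12] -/
theorem Hirahara2021_dpReconstructionK (U : UniversalMachine)
    (hPRG : ∃ (F : List Bool → List Bool) (c : ℕ), F ∈ FP ∧
      ∀ᶠ N in atTop, IsSizePseudorandom (seedGenerator F (c * Nat.log 2 N + c) N))
    {D₀ : Language Bool} (hD₀ : D₀ ∈ Classes.P) :
    ∃ p : Polynomial ℕ, ∀ (t : ℕ) (b x : List Bool) (k m e : ℕ), 1 ≤ e →
      1 / (e : ℝ) ≤ |uniformProb (x.length * k + m)
            {zr | boolPair (boolPair (unaryEncodeNat t) b) (dpGen k x (zr.take (x.length * k)) ++ zr.drop (x.length * k)) ∈ D₀} -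
          uniformProb (x.length * k + k + m) {y | boolPair (boolPair (unaryEncodeNat t) b) y ∈ D₀}| →
      U.ktAt (p.eval (t + x.length + k + m + e + b.length)) x ≤
        ((k + 2 * b.length + Nat.log 2 (p.eval (t + x.length + k + m + e + b.length)) : ℕ) : ℕ∞) := by
  classical
  obtain ⟨F, c, hF, hPR⟩ := hPRG
  obtain ⟨N₀, hN₀⟩ := Filter.eventually_atTop.1 hPR
  obtain ⟨q₁, hq₁⟩ := DPKCirc.exists_seed_dpAdvantage hD₀
  obtain ⟨q₂, hq₂⟩ := DPKCirc.exists_seed_success hD₀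
  obtain ⟨d₁, -, hd₁⟩ := UHSParam.exists_pow_bound q₁
  obtain ⟨d₂, -, hd₂⟩ := UHSParam.exists_pow_bound q₂
  obtain ⟨c₀, qg, hK⟩ := U.exists_ktAt_le_of_FP (DPKProg.gF_mem_FP hD₀ hF)
  obtain ⟨dg, -, hdg⟩ := UHSParam.exists_pow_bound qg
  -- polynomial majorants of the ruler bound and of the time
  obtain ⟨PB, hPB⟩ := (isPBounded_iff_exists_polynomial_holds _).1 (isPBounded_Bf d₁ d₂ N₀)
  obtain ⟨PT, hPT⟩ := (isPBounded_iff_exists_polynomial_holds _).1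
    (IsPBounded.pow_holds (IsPBounded.add_holds (isPBounded_Argb d₁ d₂ N₀ c) (IsPBounded.const 2)) (2 ^ dg))
  set A : ℕ := 154 + 6 * c + c₀ with hA
  refine ⟨Polynomial.C (2 ^ A) * (PB + 2) ^ A + PT, fun t b x k m e he hgap => ?_⟩
  -- notation
  set n := x.length with hn
  set N := t + n + k + m + e + b.length with hN
  have heval : (Polynomial.C (2 ^ A) * (PB + 2) ^ A + PT).eval N = 2 ^ A * (PB.eval N + 2) ^ A + PT.eval N := by
    simp [eval_add, eval_mul, eval_pow]
  rw [heval]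
  rw [unary_eq_ones] at hgap
  have he' : (0 : ℝ) < e := by exact_mod_cast he
  have hepos : (0 : ℝ) < 1 / e := div_pos one_pos he'
  have hδpos : (0 : ℝ) < 1 / (2 * e) := div_pos one_pos (by linarith)
  set a : List Bool := boolPair (ones t) b with ha
  have hlen_a : a.length = 2 * t + 2 + b.length := by rw [ha, length_boolPair, List.length_replicate]
  -- `k = 0` is impossible
  rcases Nat.eq_zero_or_pos k with hk0 | hk
  · exfalso
    subst hk0
    have hset : {zr : List Bool | boolPair a (dpGen 0 x (zr.take (n * 0)) ++ zr.drop (n * 0)) ∈ D₀} = {y | boolPair a y ∈ D₀} := by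
      ext zr; simp [dpGen]
    rw [hset] at hgap
    simp only [Nat.mul_zero, zero_add, sub_self, abs_zero] at hgap
    linarith
  -- sizes
  have htN : t ≤ N := by omega
  have hnN : n ≤ N := by omega
  have hkN : k ≤ N := by omega
  have hmN : m ≤ N := by omega
  have heN : e ≤ N := by omega
  have hbN : b.length ≤ N := by omega
  -- Step 1: the seed of the test's coins
  set N₁ := N1f d₁ N₀ N with hN₁
  have hnk : n * k ≤ N * N := Nat.mul_le_mul hnN hkN
  have hL1 : 2 * (2 * a.length + 2 + (n * k + k)) + 2 + m ≤ L1b N := by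
    rw [hlen_a]; unfold L1b; omega
  have hS1 : 2 * (2 * a.length + 2 + (n * k + k)) + 2 + m + q₁.eval (2 * (2 * a.length + 2 + (n * k + k)) + 2 + m) + 2 ≤ N₁ := by
    have h1 := hd₁ (2 * (2 * a.length + 2 + (n * k + k)) + 2 + m)
    have h2 : (2 * (2 * a.length + 2 + (n * k + k)) + 2 + m + 2) ^ (2 ^ d₁) ≤ (L1b N + 2) ^ (2 ^ d₁) :=
      Nat.pow_le_pow_left (by omega) _
    rw [hN₁]; unfold N1f; omega
  have hmN₁ : m ≤ N₁ := by rw [hN₁]; unfold N1f; omega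
  have h4e : 4 * e ≤ N₁ := by rw [hN₁]; unfold N1f; omega
  have hN₀₁ : N₀ ≤ N₁ := by rw [hN₁]; unfold N1f; omega
  have hN₁pos : 0 < N₁ := by rw [hN₁]; unfold N1f; omega
  have hfool₁ : Fools (seedGenerator F (c * Nat.log 2 N₁ + c) N₁) N₁ (1 / (N₁ : ℝ)) := hN₀ N₁ hN₀₁
  have hε₁ : 2 * (1 / (N₁ : ℝ)) < 1 / e := by
    have := two_div_le he h4e
    have : (1 : ℝ) / (2 * e) < 1 / e := by
      rw [div_lt_div_iff₀ (by positivity) he']; linarith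
    linarith [show 2 * (1 / (N₁ : ℝ)) = 2 / N₁ by ring]
  obtain ⟨σ, hσ, hadv⟩ := hq₁ a x k m N₁ (c * Nat.log 2 N₁ + c) F (1 / (N₁ : ℝ)) (1 / (e : ℝ)) hmN₁ hS1 hfool₁ hε₁ hgap
  rw [unary_eq_ones] at hadv
  set ρ : List Bool := List.takeD m (F (boolPair (ones N₁) σ)) false with hρ
  have hadv' : 1 / (2 * (e : ℝ)) ≤ dpAdvantage k x fun ω => D₀.boolIndicator (boolPair a (ω ++ ρ)) := by
    have := two_div_le he h4e
    have h' : (1 : ℝ) / e - 2 * (1 / N₁) ≤ dpAdvantage k x fun ω => D₀.boolIndicator (boolPair a (ω ++ ρ)) := hadv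
    have hsplit : (1 : ℝ) / e = 1 / (2 * e) + 1 / (2 * e) := by field_simp; ring
    linarith [show 2 * (1 / (N₁ : ℝ)) = 2 / N₁ by ring]
  -- Step 2: the hybrid argument with advice (Lemma 3.14)
  set M := Mf N with hM
  have hM1 : 1 ≤ M := by rw [hM]; unfold Mf; omega
  have hkkpos : 0 < DPHybProg.kkOf M := Nat.succ_pos _
  have h2kk : 2 ^ DPHybProg.kkOf M ≤ 2 * M := DPHybProg.two_pow_kkOf_le hM1
  have hseeds : 32 * e * e * k * k * n ≤ 2 ^ DPHybProg.kkOf M - 1 := by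
    have h1 : M ≤ 2 ^ DPHybProg.kkOf M - 1 := Nat.le_sub_one_of_lt (DPHybProg.lt_two_pow_kkOf M)
    have h2 : 32 * e * e * k * k * n ≤ M := by
      rw [hM]; unfold Mf
      calc 32 * e * e * k * k * n ≤ 32 * N * N * N * N * N := by gcongr
        _ ≤ 128 * N ^ 5 + 1 := by ring_nf; omega
    exact h2.trans h1
  set xv : List.Vector Bool n := ⟨x, hn.symm⟩ with hxv
  have hxvl : xv.toList = x := rfl
  obtain ⟨j, hj, sgn, hθ⟩ := DPHybStr.exists_uniformProb_hrun_ge (fun ω => D₀.boolIndicator (boolPair a (ω ++ ρ))) xv hk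
    (δ := 1 / (2 * (e : ℝ))) hδpos (by rw [hxvl]; exact hadv') hkkpos (seeds_enough he hk hseeds) 0
  rw [hxvl] at hθ
  -- the run is the program `hrecF`
  have hevent : {w : List Bool | DPHybStr.hrun (fun ω => D₀.boolIndicator (boolPair a (ω ++ ρ))) n k (DPHybProg.kkOf M) j sgn
      (DPHybStr.advice x n k j w) w = x} =
      {w | DPHybProg.hrecF D₀ (boolPair (DPHybProg.hparams a n k M j sgn (DPHybStr.advice x n k j w) ρ) w) = x} := by
    ext w
    simp only [Set.mem_setOf_eq]
    rw [← DPHybProg.hrecF_apply a n k M j sgn (DPHybStr.advice x n k j w) ρ w D₀ hM1]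
    rfl
  rw [hevent] at hθ
  -- Step 3: the seed of the reconstruction's coins
  set C := k * n + (k + (DPHybProg.kkOf M * n + (DPHybProg.kkOf M + 0))) with hC
  set N₂ := N2f d₂ N₀ N with hN₂
  have hkkM : DPHybProg.kkOf M ≤ M + 1 := kkOf_le M
  have hMb : M = Mf N := hM
  have hCb : C ≤ Cb N := by
    rw [hC]; unfold Cb; rw [← hMb]
    have h2 : DPHybProg.kkOf M * n ≤ DPHybProg.kkOf M * N := Nat.mul_le_mul_left _ hnN
    have hkn : k * n ≤ N * N := Nat.mul_le_mul hkN hnN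
    omega
  have hHL : (boolPair x (DPHybProg.hparams a n k M j sgn [] ρ)).length ≤ HLb N := by
    have hρl : ρ.length = m := by rw [hρ, List.takeD_length]
    have hlen1 : ∀ i : ℕ, (ones i).length = i := fun i => List.length_replicate ..
    simp only [length_boolPair, DPHybProg.hparams, hlen1, List.length_singleton, List.length_nil, hρl, hlen_a]
    unfold HLb; rw [← hMb]; omega
  have hS2 : 2 * (boolPair x (DPHybProg.hparams a n k M j sgn [] ρ)).length + 2 + C +
      q₂.eval (2 * (boolPair x (DPHybProg.hparams a n k M j sgn [] ρ)).length + 2 + C) + 2 ≤ N₂ := by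
    have h1 := hd₂ (2 * (boolPair x (DPHybProg.hparams a n k M j sgn [] ρ)).length + 2 + C)
    have hL2 : 2 * (boolPair x (DPHybProg.hparams a n k M j sgn [] ρ)).length + 2 + C ≤ L2b N := by unfold L2b; omega
    have h2 : (2 * (boolPair x (DPHybProg.hparams a n k M j sgn [] ρ)).length + 2 + C + 2) ^ (2 ^ d₂) ≤ (L2b N + 2) ^ (2 ^ d₂) :=
      Nat.pow_le_pow_left (by omega) _
    rw [hN₂]; unfold N2f; omega
  have hCN₂ : C ≤ N₂ := by rw [hN₂]; unfold N2f; omega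
  have hN₀₂ : N₀ ≤ N₂ := by rw [hN₂]; unfold N2f; omega
  have h32 : 32 * e * k * M + 1 ≤ N₂ := by
    rw [hN₂]; unfold N2f; rw [← hMb]
    have : 32 * e * k * M ≤ 32 * N * N * M := by gcongr
    omega
  have hfool₂ : Fools (seedGenerator F (c * Nat.log 2 N₂ + c) N₂) N₂ (1 / (N₂ : ℝ)) := hN₀ N₂ hN₀₂
  have hεθ : (1 : ℝ) / N₂ < 1 / (2 * (e : ℝ)) / k / 8 / 2 ^ DPHybProg.kkOf M := inv_lt_theta he hk h2kk h32
  obtain ⟨σ', hσ', hsucc⟩ := hq₂ a x ρ n k M j C N₂ (c * Nat.log 2 N₂ + c) sgn F (1 / (N₂ : ℝ)) _ hCN₂ hS2 hfool₂ hεθ hθ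
  rw [unary_eq_ones] at hsucc
  set w : List Bool := List.takeD C (F (boolPair (ones N₂) σ')) false with hw
  set α : List Bool := DPHybStr.advice x n k j w with hα
  have hαl : α.length = j := DPHybStr.length_advice _ _ _ _ _
  -- Step 4: the program
  set B := Bf d₁ d₂ N₀ N with hB
  set u : List Bool := ones (Nat.log 2 B + 1) with hu
  have hul : u.length = Nat.log 2 B + 1 := List.length_replicate ..
  have hBu : B < 2 ^ u.length := by rw [hul]; exact Nat.lt_pow_succ_log_self one_lt_two B
  have htB : t ≤ B := by rw [hB]; unfold Bf; omega
  have hnB : n ≤ B := by rw [hB]; unfold Bf; omega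
  have hkB : k ≤ B := by rw [hB]; unfold Bf; omega
  have hmB : m ≤ B := by rw [hB]; unfold Bf; omega
  have hMB : M ≤ B := by rw [hB, hMb]; unfold Bf; omega
  have hjB : j ≤ B := by omega
  have h1B : N₁ ≤ B := by rw [hB, hN₁]; unfold Bf; omega
  have h2B : N₂ ≤ B := by rw [hB, hN₂]; unfold Bf; omega
  have hCB : C ≤ B := hCb.trans (by rw [hB]; unfold Bf; omega)
  set payload := DPKProg.payloadOf t n k m M j N₁ N₂ C sgn σ σ' b α with hpay
  have hg : DPKProg.gF D₀ F (boolPair (expPad 1 u) payload) = x := by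
    have h := DPKProg.gF_apply F sgn σ σ' b α D₀ (le_of_lt (lt_of_le_of_lt htB hBu)) (le_of_lt (lt_of_le_of_lt hnB hBu))
      (le_of_lt (lt_of_le_of_lt hkB hBu)) (le_of_lt (lt_of_le_of_lt hmB hBu)) (le_of_lt (lt_of_le_of_lt hMB hBu))
      (le_of_lt (lt_of_le_of_lt hjB hBu)) (le_of_lt (lt_of_le_of_lt h1B hBu)) (le_of_lt (lt_of_le_of_lt h2B hBu))
      (le_of_lt (lt_of_le_of_lt hCB hBu))
    rw [DPKProg.zOf] at h
    rw [hpay, h]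
    exact hsucc
  have hKx := hK u payload
  rw [hg] at hKx
  -- Step 5: lengths and budgets
  have hσl : σ.length ≤ c * Nat.log 2 B + c := by
    rw [hσ]; exact Nat.add_le_add_right (Nat.mul_le_mul_left c (Nat.log_mono_right h1B)) c
  have hσ'l : σ'.length ≤ c * Nat.log 2 B + c := by
    rw [hσ']; exact Nat.add_le_add_right (Nat.mul_le_mul_left c (Nat.log_mono_right h2B)) c
  have hnums := DPKProg.length_numsOf_le htB hnB hkB hmB hMB hjB h1B h2B hCB
  have hpayl : payload.length ≤ 2 * b.length + j + PLb d₁ d₂ N₀ c N := by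
    rw [hpay, DPKProg.length_payloadOf, hαl]
    unfold PLb; rw [← hB]; omega
  have hlogpart : payload.length + 2 * u.length + c₀ ≤ k + 2 * b.length + A * (Nat.log 2 B + 1) := by
    rw [hul]
    have : PLb d₁ d₂ N₀ c N + 2 * (Nat.log 2 B + 1) + c₀ ≤ A * (Nat.log 2 B + 1) := by
      unfold PLb; rw [← hB, hA]; ring_nf; omega
    omega
  have hbudget : payload.length + 2 * u.length + c₀ ≤ k + 2 * b.length + Nat.log 2 (2 ^ A * (PB.eval N + 2) ^ A + PT.eval N) := by
    have hBP : B ≤ PB.eval N := by rw [hB]; exact hPB N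
    have := log_budget (A := A) (T := PT.eval N) hBP
    omega
  have htime : qg.eval (2 ^ u.length + payload.length) ≤ 2 ^ A * (PB.eval N + 2) ^ A + PT.eval N := by
    have harg : 2 ^ u.length + payload.length ≤ Argb d₁ d₂ N₀ c N := by
      have h2u : 2 ^ u.length ≤ 2 * B := by
        have hBpos : 0 < B := lt_of_lt_of_le hM1 hMB
        rw [hul, pow_succ]
        have := Nat.pow_log_le_self 2 hBpos.ne'; omega
      unfold Argb; rw [← hB]; omega
    have h1 := hdg (2 ^ u.length + payload.length)
    have h2 : (2 ^ u.length + payload.length + 2) ^ (2 ^ dg) ≤ (Argb d₁ d₂ N₀ c N + 2) ^ (2 ^ dg) := Nat.pow_le_pow_left (by omega) _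
    have h3 := hPT N
    omega
  -- conclusion
  calc U.ktAt (2 ^ A * (PB.eval N + 2) ^ A + PT.eval N) x ≤ U.ktAt (qg.eval (2 ^ u.length + payload.length)) x := U.ktAt_anti htime x
    _ ≤ (payload.length : ℕ∞) + 2 * (u.length : ℕ∞) + (c₀ : ℕ∞) := hKx
    _ = ((payload.length + 2 * u.length + c₀ : ℕ) : ℕ∞) := by push_cast; ring
    _ ≤ ((k + 2 * b.length + Nat.log 2 (2 ^ A * (PB.eval N + 2) ^ A + PT.eval N) : ℕ) : ℕ∞) := by exact_mod_cast hbudget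

end DPK

export DPK (Hirahara2021_dpReconstructionK)

end Literature.Computability.MetaComplexity

end
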